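import Summits.BirchSwinnertonDyer.BirchSwinnertonDyer.Theorems.ResidualThetaTransportAtTwoThetaLayerLambdaCongruenceAtTwoStarGalois
import Literature.NumberTheory.GaloisRepresentations.IntegralGaloisActionProofs
import HarnessLib

/-!
# Route `ResidualThetaTransportAtTwo`, crux Kμ⁺ `SignedMuVanishingAtTwoPlus` (stmt-BirchSwinnertonDyer-20689), line
# `birth`, stub `stub_flatMuZeroAtTwo`: the old-class descent's congruence input `hcongr` — «`a_p(W) ≡ a_p(A) (mod 2)` at the
# good primes» FROM a Galois-equivariant isomorphism `W[2] ≅ A[2]` (the kernel-checked Tschirnhaus certificates of cell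
# `bsd-2adic`, `SSUnitAnchor.twoTorsion_congruent_*`)

Cell `bsd-wall`, width seat `bsd-wall-rtt-p4-w2` (g4). THEOREMS ONLY (no `def`, no named fact, no `sorry`); helper `--supports`
the crux; closes nothing. BSD is not proved by this.

## What is proved
* `IsTorsionGaloisRep.of_equivariant_addEquiv` — a framed model `ρ̄` of `W[n]` is a framed model of `A[n]` whenever
  `W[n] ≅ A[n]` Galois-equivariantly (transport of the frame).
* `lFunction_congr_two_of_geomTorsion_equiv` — for elliptic `W, A /ℚ` with `W[2] ≅ A[2]` (equivariant additive isomorphism) and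
  a prime `p ≠ 2` of good reduction for both (`p ∤ N_W`, `p ∤ N_A`): `a_p(W) ≡ a_p(A) (mod 2)` (`W.LFunction p`, the `p`-th
  coefficient = trace of Frobenius). Proof: one framed `ρ̄ : G_ℚ → GL₂(𝔽₂)` models both `W[2]` and `A[2]`; at an arithmetic
  Frobenius `σ` above `p` (which exists, `exists_isArithFrobAt_of_mem_primesAbove_holds`) its characteristic polynomial is both
  `X² − a_p(W) X + p` and `X² − a_p(A) X + p` mod `2` (`IsTorsionGaloisRep.charpoly_eq_of_isArithFrobAt`, the discharged
  trace/determinant of Frobenius on `T₂`); compare the coefficients of `X`.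
* `eigenvalue_congr_two_of_geomTorsion_equiv` — the hypothesis `hcongr` of `…OldClassCongruence.flatAtTwo_of_multOne` /
  `…MultOneHabitat.flatAtTwo_of_namedFacts` for the newforms `f` of `W` and `g` of an anchor `A` with `N_A ∣ N_W` and
  `a₂(f)`, `a₂(g)` even: `a_p(f) ≡ a_p(g) (mod 2)` for every prime `p ∤ N_W`.

References: J. H. Silverman, AEC III.7, V.2 (trace of Frobenius on `E[ℓ]`), VII.4.1 [SilvermanAEC2009]; J.-P. Serre,
*Abelian ℓ-adic representations* I.2.1–2.3 [SerreAbelianLadic1968]; [CremonaAlgorithms1997] §2.8 (congruent curves).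
-/

set_option autoImplicit false
set_option linter.dupNamespace false

noncomputable section

open scoped Classical MatrixGroups ModularForm NumberField

open CongruenceSubgroup Polynomial IsDedekindDomain Field Matrix WeierstrassCurve Literature.NumberTheory.EllipticCurves
  Literature.NumberTheory.EllipticCurves.ModularForms Literature.NumberTheory.EllipticCurves.Rank1Residual
  Literature.NumberTheory.GaloisRepresentations Rat.HeightOneSpectrum
  Summit.BirchSwinnertonDyer.BirchSwinnertonDyer.Theorems.ThetaLayerLambdaCongruenceAtTwo

namespace Summit.BirchSwinnertonDyer.BirchSwinnertonDyer.Theorems.SignedMuAtTwo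

namespace MultOneDictionary

/-- **Transport of a framed torsion representation along `W[n] ≅ A[n]`.** If `ρ̄ : Γ_ℚ → GL₂(ℤ/n)` is a framed model of
`W[n]` and `e : W[n] ≃ A[n]` is additive and Galois-equivariant, then `ρ̄` is a framed model of `A[n]` (frame `e⁻¹` followed by
the frame of `W[n]`). [cite: SilvermanAEC2009, III.7] -/
theorem IsTorsionGaloisRep.of_equivariant_addEquiv {W A : WeierstrassCurve ℚ} {n : ℕ}
    {ρ : FramedGaloisRep ℚ (ZMod n) 2} (hρ : W.IsTorsionGaloisRep n ρ)
    (e : geomTorsion W n ≃+ geomTorsion A n)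
    (he : ∀ (σ : absoluteGaloisGroup ℚ) (P : geomTorsion W n), e (σ • P) = σ • e P) :
    A.IsTorsionGaloisRep n ρ := by
  obtain ⟨eW, heW⟩ := hρ
  refine ⟨e.symm.trans eW, fun σ Q ↦ ?_⟩
  have hsymm : e.symm (σ • Q) = σ • e.symm Q := by
    apply e.injective
    rw [AddEquiv.apply_symm_apply, he, AddEquiv.apply_symm_apply]
  rw [AddEquiv.trans_apply, AddEquiv.trans_apply, hsymm, heW]

/-- **`a_p(W) ≡ a_p(A) (mod 2)` at a common good prime `p ≠ 2`, from `W[2] ≅ A[2]`.** For elliptic curves `W, A` over `ℚ`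
with a Galois-equivariant additive isomorphism `W[2] ≃ A[2]` and a prime `p ≠ 2` with `p ∤ N_W`, `p ∤ N_A`: the `p`-th
`L`-series coefficients (traces of Frobenius) agree mod `2`. One framed `ρ̄ = ρ̄_{W,2}` models both; at an arithmetic Frobenius
`σ` over `p` its characteristic polynomial is `X² − a_p(W)X + p = X² − a_p(A)X + p` in `𝔽₂[X]`.
[cite: SilvermanAEC2009, V.2 and VII.4.1] [cite: SerreAbelianLadic1968, Ch. I §2.1–2.3] -/
theorem lFunction_congr_two_of_geomTorsion_equiv (W A : WeierstrassCurve ℚ) [W.IsElliptic] [A.IsElliptic]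
    (e : geomTorsion W (2 : ℕ) ≃+ geomTorsion A (2 : ℕ))
    (he : ∀ (σ : absoluteGaloisGroup ℚ) (P : geomTorsion W (2 : ℕ)), e (σ • P) = σ • e P)
    {p : ℕ} (hp : p.Prime) (hp2 : p ≠ 2) (hpW : ¬ p ∣ W.conductorNorm ℤ) (hpA : ¬ p ∣ A.conductorNorm ℤ) :
    ((W.LFunction p : ℤ) : ZMod 2) = ((A.LFunction p : ℤ) : ZMod 2) := by
  obtain ⟨ρ, hρW⟩ := W.exists_isTorsionGaloisRep 2
  have hρA : A.IsTorsionGaloisRep 2 ρ := IsTorsionGaloisRep.of_equivariant_addEquiv hρW e he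
  -- the place `v` over `p`, a prime `𝔓 ∣ v` of `ℤ̄`, an arithmetic Frobenius `σ`
  set v : HeightOneSpectrum (𝓞 ℚ) := primesEquiv.symm ⟨p, hp⟩ with hvdef
  have hvp : ((primesEquiv v : Nat.Primes) : ℕ) = p := by simp [hvdef]
  have hgoodW : W.HasGoodReductionAt v := by
    by_contra h; exact hpW (hvp ▸ (W.dvd_conductorNorm_iff v).mpr h)
  have hgoodA : A.HasGoodReductionAt v := by
    by_contra h; exact hpA (hvp ▸ (A.dvd_conductorNorm_iff v).mpr h)
  have h2v : ((2 : ℕ) : 𝓞 ℚ) ∉ v.asIdeal := fun h ↦ by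
    have := (natCast_mem_asIdeal_iff_primesEquiv_dvd v 2).mp h
    rw [hvp] at this
    exact hp2 ((Nat.prime_dvd_prime_iff_eq hp Nat.prime_two).mp this)
  obtain ⟨𝔓, h𝔓⟩ := HeightOneSpectrum.primesAbove_nonempty (v := v)
  obtain ⟨σ, hσ⟩ := HeightOneSpectrum.exists_isArithFrobAt_of_mem_primesAbove_holds h𝔓
  have hW := hρW.charpoly_eq_of_isArithFrobAt (W.trace_galoisRepTate_frobenius_of_hasGoodReductionAt_holds 2)
    (W.det_galoisRepTate_frobenius_of_hasGoodReductionAt_holds 2) h2v hgoodW h𝔓 hσ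
  have hA := hρA.charpoly_eq_of_isArithFrobAt (A.trace_galoisRepTate_frobenius_of_hasGoodReductionAt_holds 2)
    (A.det_galoisRepTate_frobenius_of_hasGoodReductionAt_holds 2) h2v hgoodA h𝔓 hσ
  have heq := hW.symm.trans hA
  -- compare the coefficients of `X`
  have hc := congrArg (fun P : (ZMod 2)[X] ↦ P.coeff 1) heq
  simp only [coeff_add, coeff_sub, coeff_X_pow, coeff_C_mul, coeff_X_one, coeff_C, if_neg (one_ne_zero),
    show (1 : ℕ) ≠ 2 from by decide, if_false, mul_one, zero_sub, add_zero, neg_inj] at hc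
  rw [← W.lFunction_primesEquiv_eq_frobeniusTraceAt hgoodW, ← A.lFunction_primesEquiv_eq_frobeniusTraceAt hgoodA, hvp] at hc
  exact hc

/-- **The descent's `hcongr` from `W[2] ≅ A[2]`.** Let `f` be the newform of `W` and `g` the newform of an elliptic curve `A`
over `ℚ` (`IsNewformOf`), with integer eigenvalue functions `a p = a_p(f)`, `b p = a_p(g)`, `N_A ∣ N_W`, `a 2` and `b 2` even,
and `W[2] ≅ A[2]` Galois-equivariantly. Then `a p ≡ b p (mod 2)` for every prime `p ∤ N_W` — the hypothesis `hcongr` of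
`…OldClassCongruence.flatAtTwo_of_multOne` / `…MultOneHabitat.flatAtTwo_of_namedFacts`. [cite: CremonaAlgorithms1997, §2.8]
[cite: SilvermanAEC2009, V.2 and VII.4.1] -/
theorem eigenvalue_congr_two_of_geomTorsion_equiv (W A : WeierstrassCurve ℚ) [W.IsElliptic] [A.IsElliptic]
    (e : geomTorsion W (2 : ℕ) ≃+ geomTorsion A (2 : ℕ))
    (he : ∀ (σ : absoluteGaloisGroup ℚ) (P : geomTorsion W (2 : ℕ)), e (σ • P) = σ • e P)
    (hNA : A.conductorNorm ℤ ∣ W.conductorNorm ℤ)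
    {N : ℕ} [NeZero N] {f : CuspForm (Gamma0 N) 2} (hf : IsNewformOf W f)
    {N₀ : ℕ} [NeZero N₀] {g : CuspForm (Gamma0 N₀) 2} (hg : IsNewformOf A g)
    (a b : ℕ → ℤ) (ha : ∀ p : ℕ, p.Prime → cuspCoeff f p = (a p : ℂ)) (hb : ∀ p : ℕ, p.Prime → cuspCoeff g p = (b p : ℂ))
    (ha2 : Even (a 2)) (hb2 : Even (b 2)) :
    ∀ p : ℕ, p.Prime → ¬ p ∣ W.conductorNorm ℤ → ((a p : ℤ) : ZMod 2) = ((b p : ℤ) : ZMod 2) := by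
  intro p hp hpW
  by_cases hp2 : p = 2
  · subst hp2
    rw [(ZMod.intCast_zmod_eq_zero_iff_dvd _ 2).mpr (even_iff_two_dvd.mp ha2),
      (ZMod.intCast_zmod_eq_zero_iff_dvd _ 2).mpr (even_iff_two_dvd.mp hb2)]
  have hpA : ¬ p ∣ A.conductorNorm ℤ := fun h ↦ hpW (h.trans hNA)
  have haW : a p = W.LFunction p := by
    have h := (ha p hp).symm.trans (hf.2 p)
    exact_mod_cast h
  have hbA : b p = A.LFunction p := by
    have h := (hb p hp).symm.trans (hg.2 p)
    exact_mod_cast h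
  rw [haW, hbA]
  exact lFunction_congr_two_of_geomTorsion_equiv W A e he hp hp2 hpW hpA

end MultOneDictionary

end Summit.BirchSwinnertonDyer.BirchSwinnertonDyer.Theorems.SignedMuAtTwo

end
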